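import Summits.QuantumAdvantage.QuantumAdvantage.Theorems.ResponseDialHA

/-! # ResponseDialH — ResponseDial REV 1 delta part 5/6 (mechanical split for landing; content verbatim; scopes re-opened with their variables) -/

set_option linter.dupNamespace false
noncomputable section
open scoped Classical

namespace Summit.QuantumAdvantage.QuantumAdvantage.Theorems.ResponseDial
open Finset
open Literature.Computability.QuantumComplexity Literature.Computability.QuantumComplexity.RingHLF
open Literature.Computability.MetaComplexity Literature.Computability.MetaComplexity.Smolensky
open Summit.QuantumAdvantage.AdviceFreeQNC0
open Summit.QuantumAdvantage.QuantumAdvantage.Theorems.AnchorDial (outB dev cN orbF orbL orbL_cons fz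
  cN_orbF_cast oddZeros_orbF win_iff gCond_iff_cN card_filter_orbF orbF_false flip2 card_odd_ge loss_shape_mono)
open Summit.QuantumAdvantage.QuantumAdvantage.Theorems.AnchorDial.Core (ct sg)
open Summit.QuantumAdvantage.QuantumAdvantage.Theorems.HolonomyDial (gCond tPoly tPoly_apply tPoly_mem card_odd_le
  xorP xorP_mem xorP_apply_bool mono_singleton_apply indP indP_mem indP_apply)
open Summit.QuantumAdvantage.QuantumAdvantage.Theorems.StabilizerDial (apIdx apStrat apStrat_mem bitP bitP_apStrat
  pad rel_pad_iff outB_pad_zero pad_mem StabFew rowMask bitP_pad mem_dev_pad_apStrat_iff BlockRec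
  blockSelect_of_fewLocus goodBound_of_blockRec fibreIdentityAt_of_block oddSliceBound_holds eventually_polylog
  side_bounds)
open Summit.QuantumAdvantage.QuantumAdvantage.Theorems.LocusDial (Coverable FewLocus)
open Summit.QuantumAdvantage.QuantumAdvantage.Theorems.SparsityDial (real_loss_of_frac AntipodalLoss3 stabFew_mono_mr
  one_le_logpow)
open Summit.QuantumAdvantage.QuantumAdvantage.Theses.SparsityDial (DenseGenericLoss3)

section MultiCounterLaw
variable {N : ℕ}

/-- **THE MULTI-COUNTER LAW, pointwise**: a conditioned odd base point has a losing orbit image. -/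
theorem multi_orbit_loses (hN : 40 ≤ N) (x : Fin N → Bool) (hx : OddZeros x) (hfix : FixM x) :
    ∃ ε : Fin 5 → Bool, ¬ Rel (orbF hcSite ε x) (outB (fun i : Fin N => mcStrat i) (orbF hcSite ε x)) := by
  have hN22 : 22 ≤ N := by omega
  have hb := hcSite_sep
  have hbN := hcSite_le (N := N) (by omega : 22 ≤ N)
  have hx0 : ∀ i : Fin 5, x (oddSite hbN i) = false := by
    intro i
    refine hfix.1 _ ?_
    rw [oddSite_hcSite hbN i]
    have := i.isLt
    interval_cases (i.val) <;> decide
  set z : Fin 5 → Bool := fun i => zpar x (hcSite i + 1) with hz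
  -- the forced sign pattern `(z₀, a, ¬a, ¬a, a)`
  have h7 : x ⟨7, by omega⟩ = false := hfix.1 _ (show (7 : ℕ) ∈ JM0 from by decide)
  have h8 : x ⟨8, by omega⟩ = true := hfix.2 _ (show (8 : ℕ) ∈ JM1 from by decide)
  have h9 : x ⟨9, by omega⟩ = true := hfix.2 _ (show (9 : ℕ) ∈ JM1 from by decide)
  have h10 : x ⟨10, by omega⟩ = true := hfix.2 _ (show (10 : ℕ) ∈ JM1 from by decide)
  have h11 : x ⟨11, by omega⟩ = false := hfix.1 _ (show (11 : ℕ) ∈ JM0 from by decide)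
  have h12 : x ⟨12, by omega⟩ = false := hfix.1 _ (show (12 : ℕ) ∈ JM0 from by decide)
  have h13 : x ⟨13, by omega⟩ = true := hfix.2 _ (show (13 : ℕ) ∈ JM1 from by decide)
  have h14 : x ⟨14, by omega⟩ = true := hfix.2 _ (show (14 : ℕ) ∈ JM1 from by decide)
  have h15 : x ⟨15, by omega⟩ = false := hfix.1 _ (show (15 : ℕ) ∈ JM0 from by decide)
  have h16 : x ⟨16, by omega⟩ = true := hfix.2 _ (show (16 : ℕ) ∈ JM1 from by decide)
  have h17 : x ⟨17, by omega⟩ = true := hfix.2 _ (show (17 : ℕ) ∈ JM1 from by decide)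
  have h18 : x ⟨18, by omega⟩ = true := hfix.2 _ (show (18 : ℕ) ∈ JM1 from by decide)
  have s8 : zpar x 8 = xor (zpar x 7) (!x ⟨7, by omega⟩) := zpar_succ x (k := 7) (by omega)
  have s9 : zpar x 9 = xor (zpar x 8) (!x ⟨8, by omega⟩) := zpar_succ x (k := 8) (by omega)
  have s10 : zpar x 10 = xor (zpar x 9) (!x ⟨9, by omega⟩) := zpar_succ x (k := 9) (by omega)
  have s11 : zpar x 11 = xor (zpar x 10) (!x ⟨10, by omega⟩) := zpar_succ x (k := 10) (by omega)
  have s12 : zpar x 12 = xor (zpar x 11) (!x ⟨11, by omega⟩) := zpar_succ x (k := 11) (by omega)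
  have s13 : zpar x 13 = xor (zpar x 12) (!x ⟨12, by omega⟩) := zpar_succ x (k := 12) (by omega)
  have s14 : zpar x 14 = xor (zpar x 13) (!x ⟨13, by omega⟩) := zpar_succ x (k := 13) (by omega)
  have s15 : zpar x 15 = xor (zpar x 14) (!x ⟨14, by omega⟩) := zpar_succ x (k := 14) (by omega)
  have s16 : zpar x 16 = xor (zpar x 15) (!x ⟨15, by omega⟩) := zpar_succ x (k := 15) (by omega)
  have s17 : zpar x 17 = xor (zpar x 16) (!x ⟨16, by omega⟩) := zpar_succ x (k := 16) (by omega)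
  have s18 : zpar x 18 = xor (zpar x 17) (!x ⟨17, by omega⟩) := zpar_succ x (k := 17) (by omega)
  have s19 : zpar x 19 = xor (zpar x 18) (!x ⟨18, by omega⟩) := zpar_succ x (k := 18) (by omega)
  have e1 : hcSite 1 + 1 = 7 := by decide
  have e2 : hcSite 2 + 1 = 11 := by decide
  have e3 : hcSite 3 + 1 = 15 := by decide
  have e4 : hcSite 4 + 1 = 19 := by decide
  have hz11 : zpar x 11 = !zpar x 7 := by
    rw [s11, s10, s9, s8, h7, h8, h9, h10]; cases zpar x 7 <;> decide
  have hz15 : zpar x 15 = !zpar x 7 := by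
    rw [s15, s14, s13, s12, hz11, h11, h12, h13, h14]; cases zpar x 7 <;> decide
  have hz19 : zpar x 19 = zpar x 7 := by
    rw [s19, s18, s17, s16, hz15, h15, h16, h17, h18]; cases zpar x 7 <;> decide
  have hz2 : z 2 = !z 1 := by
    show zpar x (hcSite 2 + 1) = !zpar x (hcSite 1 + 1); rw [e1, e2, hz11]
  have hz3 : z 3 = !z 1 := by
    show zpar x (hcSite 3 + 1) = !zpar x (hcSite 1 + 1); rw [e1, e3, hz15]
  have hz4 : z 4 = z 1 := by
    show zpar x (hcSite 4 + 1) = zpar x (hcSite 1 + 1); rw [e1, e4, hz19]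
  obtain ⟨hodd, hc1, hc2⟩ := certOKM_lam z hz2 hz3 hz4
  by_contra hall
  push Not at hall
  set gk : Fin N → ℕ := fun k => (univ.filter fun i : Fin 5 => hcSite i + 1 ≤ k.val).card with hgk
  have hgk6 : ∀ k, gk k < 6 := fun k =>
    Nat.lt_succ_of_le (le_trans (card_le_univ _) (by simp))
  set c : Fin N → ZMod 3 := fun k => ((cN x k.val : ℕ) : ZMod 3) with hc
  -- the deviation structure along the orbit
  have hD1 : ∀ (ε : Fin 5 → Bool) (k : Fin N), (1 ≤ k.val ∧ k.val < N / 2) →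
      (k ∈ dev (fun i : Fin N => mcStrat i) (orbF hcSite ε x) ↔ x (apIdx k) = true) := by
    intro ε k hk
    rw [mem_dev_mc_first _ k hk, orbF_apply hb ε x (apIdx k), if_neg]
    rintro ⟨i, -, hi⟩
    have hap : N / 2 ≤ (apIdx k).val := by
      show N / 2 ≤ (k.val + N / 2) % N
      rw [Nat.mod_eq_of_lt (by omega)]; omega
    have := i.isLt
    unfold hcSite at hi
    omega
  have hD2 : ∀ (ε : Fin 5 → Bool) (k : Fin N), ¬ (1 ≤ k.val ∧ k.val < N / 2) →
      (k ∈ dev (fun i : Fin N => mcStrat i) (orbF hcSite ε x) ↔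
        decide ((loddW k) x + wsum hbN x k ε = 0) = true) := by
    intro ε k hk
    rw [mem_dev_mcStrat_iff _ k hk]
    unfold qbitW
    rw [loddW_orbF hb hbN k ε x]
    rfl
  -- the win parity at each orbit point, in two blocks
  have hW : ∀ ε : Fin 5 → Bool,
      (∑ k : Fin N, (if (1 ≤ k.val ∧ k.val < N / 2) ∧ x (apIdx k) = true ∧ c k + sF z ε (gk k) ≠ 2
          then (1 : ZMod 2) else 0)) +
        ∑ k : Fin N, (if ¬ (1 ≤ k.val ∧ k.val < N / 2) ∧
            decide ((loddW k) x + wsum hbN x k ε = 0) = true ∧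
            c k + sF z ε (gk k) ≠ 2 then (1 : ZMod 2) else 0) = 1 := by
    intro ε
    have ho : OddZeros (orbF hcSite ε x) := (oddZeros_orbF hbN ε x).2 hx
    have hwin := (win_iff (by omega) (fun i : Fin N => mcStrat i) _ ho).1 (hall ε)
    have hphase : ∀ k : Fin N, gCond (orbF hcSite ε x) k.val ↔ c k + sF z ε (gk k) ≠ 2 := by
      intro k
      rw [gCond_iff_cN, mod3_ne_two, cN_orbF_cast x hb hbN ε k.val (le_of_lt k.isLt), shift_eq hb]
    have hfilt : ((dev (fun i : Fin N => mcStrat i) (orbF hcSite ε x)).filter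
        fun k => gCond (orbF hcSite ε x) k.val) =
        univ.filter fun k => k ∈ dev (fun i : Fin N => mcStrat i) (orbF hcSite ε x) ∧
          c k + sF z ε (gk k) ≠ 2 := by
      ext k
      rw [mem_filter, mem_filter, hphase k]
      simp only [mem_univ, true_and]
    rw [hfilt] at hwin
    have h1 : (((univ.filter fun k => k ∈ dev (fun i : Fin N => mcStrat i) (orbF hcSite ε x) ∧
        c k + sF z ε (gk k) ≠ 2).card : ℕ) : ZMod 2) = 1 := castZ2_of_mod_eq_one hwin
    rw [natCast_card_filter] at h1
    refine Eq.trans ?_ h1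
    rw [← sum_add_distrib]
    refine sum_congr rfl fun k _ => ?_
    by_cases hk : 1 ≤ k.val ∧ k.val < N / 2
    · have hiff := hD1 ε k hk
      by_cases hφ : c k + sF z ε (gk k) = 2
      · simp [hφ]
      · by_cases hxa : x (apIdx k) = true
        · have hm : k ∈ dev (fun i : Fin N => mcStrat i) (orbF hcSite ε x) := hiff.2 hxa
          simp [hk, hφ, hxa, hm]
        · have hm : k ∉ dev (fun i : Fin N => mcStrat i) (orbF hcSite ε x) := fun h => hxa (hiff.1 h)
          simp [hk, hφ, hxa, hm]
    · have hiff := hD2 ε k hk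
      by_cases hφ : c k + sF z ε (gk k) = 2
      · simp [hφ]
      · by_cases ht : decide ((loddW k) x + wsum hbN x k ε = 0) = true
        · have hm : k ∈ dev (fun i : Fin N => mcStrat i) (orbF hcSite ε x) := hiff.2 ht
          simp only [hk, ht, hm]; simp
        · have hm : k ∉ dev (fun i : Fin N => mcStrat i) (orbF hcSite ε x) := fun h => ht (hiff.1 h)
          simp only [hk, ht, hm]; simp
  -- sum the win parities over the certificate
  have hLsum : ((lamM z).map fun j =>
      (∑ k : Fin N, (if (1 ≤ k.val ∧ k.val < N / 2) ∧ x (apIdx k) = true ∧ c k + sF z (εOf j) (gk k) ≠ 2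
          then (1 : ZMod 2) else 0)) +
        ∑ k : Fin N, (if ¬ (1 ≤ k.val ∧ k.val < N / 2) ∧
            decide ((loddW k) x + wsum hbN x k (εOf j) = 0) = true ∧
            c k + sF z (εOf j) (gk k) ≠ 2 then (1 : ZMod 2) else 0)).sum =
      ((lamM z).map fun _ => (1 : ZMod 2)).sum := by
    congr 1
    exact List.map_congr_left fun j _ => hW (εOf j)
  have hR : ((lamM z).map fun _ => (1 : ZMod 2)).sum = 1 := by
    rw [List.map_const', List.sum_replicate, nsmul_eq_mul, mul_one]
    exact castZ2_of_mod_eq_one hodd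
  rw [hR, List.sum_map_add] at hLsum
  -- block 1 (frozen first-half indicators)
  have hA : ((lamM z).map fun j =>
      ∑ k : Fin N, (if (1 ≤ k.val ∧ k.val < N / 2) ∧ x (apIdx k) = true ∧ c k + sF z (εOf j) (gk k) ≠ 2
          then (1 : ZMod 2) else 0)).sum = 0 := by
    rw [list_sum_swap]
    refine sum_eq_zero fun k _ => ?_
    by_cases hD : (1 ≤ k.val ∧ k.val < N / 2) ∧ x (apIdx k) = true
    · have h0 : ((lamM z).map fun j =>
          if decide (c k + sF z (εOf j) (gk k) ≠ 2) = true then (1 : ZMod 2) else 0).sum = 0 := by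
        rw [list_sum_ite]; exact castZ2_of_mod_eq_zero (hc1 ⟨gk k, hgk6 k⟩ (c k))
      refine Eq.trans ?_ h0
      congr 1
      refine List.map_congr_left fun j _ => ?_
      by_cases h : c k + sF z (εOf j) (gk k) = 2 <;> simp [h, hD.1, hD.2]
    · have : ∀ j ∈ lamM z, (if (1 ≤ k.val ∧ k.val < N / 2) ∧ x (apIdx k) = true ∧
          c k + sF z (εOf j) (gk k) ≠ 2 then (1 : ZMod 2) else 0) = 0 :=
        fun j _ => if_neg (fun h => hD ⟨h.1, h.2.1⟩)
      rw [List.map_congr_left this]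
      simp
  -- block 2 (position 0 and the second half-cycle: window counters)
  have hB : ((lamM z).map fun j =>
      ∑ k : Fin N, (if ¬ (1 ≤ k.val ∧ k.val < N / 2) ∧
          decide ((loddW k) x + wsum hbN x k (εOf j) = 0) = true ∧
          c k + sF z (εOf j) (gk k) ≠ 2 then (1 : ZMod 2) else 0)).sum = 0 := by
    rw [list_sum_swap]
    refine sum_eq_zero fun k _ => ?_
    by_cases hk : 1 ≤ k.val ∧ k.val < N / 2
    · have : ∀ j ∈ lamM z, (if ¬ (1 ≤ k.val ∧ k.val < N / 2) ∧
          decide ((loddW k) x + wsum hbN x k (εOf j) = 0) = true ∧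
          c k + sF z (εOf j) (gk k) ≠ 2 then (1 : ZMod 2) else 0) = 0 :=
        fun j _ => if_neg (fun h => h.1 hk)
      rw [List.map_congr_left this]
      simp
    · rcases Nat.lt_or_ge k.val 1 with h0 | h1
      · -- position 0: empty window, always deviating, group 0
        have hk0 : k.val = 0 := by omega
        have hg : gk k = 0 := by
          show (univ.filter fun i : Fin 5 => hcSite i + 1 ≤ k.val).card = 0
          rw [Finset.card_eq_zero, filter_eq_empty_iff]
          intro i _
          unfold hcSite; omega
        have hTt : ∀ ε, decide ((loddW k) x + wsum hbN x k ε = 0) = true := by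
          intro ε; rw [loddW_apply_zero k hk0, wsum_zero hbN x k hk0]; decide
        have h0' : ((lamM z).map fun j =>
            if decide (c k + sF z (εOf j) (gk k) ≠ 2) = true then (1 : ZMod 2) else 0).sum = 0 := by
          rw [list_sum_ite]; exact castZ2_of_mod_eq_zero (hc1 ⟨gk k, hgk6 k⟩ (c k))
        refine Eq.trans ?_ h0'
        congr 1
        refine List.map_congr_left fun j _ => ?_
        by_cases h : c k + sF z (εOf j) (gk k) = 2 <;> simp [h, hk, hTt]
      · -- second half-cycle: group 5, threshold `min (k − N/2) 20`
        have hk2 : N / 2 ≤ k.val := by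
          by_contra hlt
          exact hk ⟨h1, by omega⟩
        have hg : gk k = 5 := by
          show (univ.filter fun i : Fin 5 => hcSite i + 1 ≤ k.val).card = 5
          rw [filter_true_of_mem fun i _ => ?_, card_univ, Fintype.card_fin]
          have := i.isLt
          unfold hcSite; omega
        have ht21 : min (k.val - N / 2) 20 < 21 := by omega
        have hws : ∀ ε, wsum hbN x k ε = cntT5 (min (k.val - N / 2) 20) ε :=
          fun ε => wsum_eq hN x hx0 k hk2 ε
        have h0' : ((lamM z).map fun j =>
            if (decide ((loddW k) x + cntT5 (min (k.val - N / 2) 20) (εOf j) = 0) &&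
              decide (c k + sF z (εOf j) 5 ≠ 2)) = true then (1 : ZMod 2) else 0).sum = 0 := by
          rw [list_sum_ite]
          exact castZ2_of_mod_eq_zero (hc2 ⟨min (k.val - N / 2) 20, ht21⟩ ((loddW k) x) (c k))
        refine Eq.trans ?_ h0'
        congr 1
        refine List.map_congr_left fun j _ => ?_
        rw [hws (εOf j), hg]
        by_cases h : c k + sF z (εOf j) 5 = 2 <;>
          by_cases ht : (loddW k) x + cntT5 (min (k.val - N / 2) 20) (εOf j) = 0 <;> simp [h, ht, hk]
  rw [hA, hB, add_zero] at hLsum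
  exact zero_ne_one hLsum

/-- **THE MULTI-COUNTER LAW (counting)**. -/
theorem multi_loss_count (hN : 40 ≤ N) :
    (univ.filter fun x : Fin N → Bool => OddZeros x ∧ FixM x).card ≤
      32 * (univ.filter fun x : Fin N → Bool =>
        OddZeros x ∧ ¬ Rel x (outB (fun i : Fin N => mcStrat i) x)).card := by
  refine le_trans (card_le_card fun x hx => ?_)
    (card_exists_orbF_le hcSite (fun y : Fin N → Bool =>
      OddZeros y ∧ ¬ Rel y (outB (fun i : Fin N => mcStrat i) y)))
  rw [mem_filter] at hx ⊢
  obtain ⟨-, hodd, hfix⟩ := hx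
  obtain ⟨ε, hε⟩ := multi_orbit_loses hN x hodd hfix
  exact ⟨mem_univ _, ε, (oddZeros_orbF (hcSite_le (by omega)) ε x).2 hodd, hε⟩

/-! ### conditioning: a `2⁻¹⁵` fraction up to parity repair -/

/-- generic fibre bound: a map that changes only cells in `T` is `2^{#T}`-to-one. -/
theorem fibre_le_pow (T : Finset (Fin N)) (f : (Fin N → Bool) → (Fin N → Bool))
    (hf : ∀ x j, j ∉ T → f x j = x j) (y : Fin N → Bool) (s : Finset (Fin N → Bool)) :
    (s.filter fun x => f x = y).card ≤ 2 ^ T.card := by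
  have h := card_le_card_of_injOn (s := s.filter fun x => f x = y) (t := (univ : Finset (T → Bool)))
    (fun x : Fin N → Bool => fun j : T => x j.1) (fun _ _ => mem_univ _) ?_
  · refine le_trans h ?_
    rw [card_univ, Fintype.card_fun, Fintype.card_bool, Fintype.card_coe]
  · intro x hx x' hx' hxx'
    rw [Finset.mem_coe, mem_filter] at hx hx'
    funext j
    by_cases hj : j ∈ T
    · exact congrFun hxx' ⟨j, hj⟩
    · rw [← hf x j hj, ← hf x' j hj, hx.2, hx'.2]

/-- ResponseDialH helper `fixJM` (decomp-qadv land package; see the module docstring). -/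
def fixJM (x : Fin N → Bool) : Fin N → Bool := fun j =>
  if j.val ∈ JM0 then false else if j.val ∈ JM1 then true else x j

/-- ResponseDialH helper `fixJM_fixM` (decomp-qadv land package; see the module docstring). -/
theorem fixJM_fixM (x : Fin N → Bool) : FixM (fixJM x) := by
  refine ⟨fun j hj => ?_, fun j hj => ?_⟩
  · unfold fixJM; rw [if_pos hj]
  · have h0 : j.val ∉ JM0 := by
      intro h
      have : j.val ∈ JM0 ∩ JM1 := mem_inter.2 ⟨h, hj⟩
      rw [show JM0 ∩ JM1 = ∅ from by decide] at this
      simp at this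
    unfold fixJM; rw [if_neg h0, if_pos hj]

/-- ResponseDialH helper `fixupM` (decomp-qadv land package; see the module docstring). -/
def fixupM (hN : 1 ≤ N) (x : Fin N → Bool) : Fin N → Bool :=
  if OddZeros (fixJM x) then fixJM x else tog0 hN (fixJM x)

/-- ResponseDialH helper `fixupM_odd` (decomp-qadv land package; see the module docstring). -/
theorem fixupM_odd (hN : 1 ≤ N) (x : Fin N → Bool) : OddZeros (fixupM hN x) := by
  unfold fixupM
  split_ifs with h
  · exact h
  · exact (oddZeros_tog0 hN _).2 h

/-- ResponseDialH helper `fixupM_fixM` (decomp-qadv land package; see the module docstring). -/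
theorem fixupM_fixM (hN : 1 ≤ N) (x : Fin N → Bool) : FixM (fixupM hN x) := by
  unfold fixupM
  split_ifs with h
  · exact fixJM_fixM x
  · obtain ⟨h1, h2⟩ := fixJM_fixM x
    refine ⟨fun j hj => ?_, fun j hj => ?_⟩
    · have hj0 : j ≠ ⟨0, hN⟩ := by
        intro e; rw [e] at hj
        have hj' : (0 : ℕ) ∈ JM0 := hj
        exact absurd hj' (by decide)
      show Function.update (fixJM x) ⟨0, hN⟩ (!fixJM x ⟨0, hN⟩) j = false
      rw [Function.update_of_ne hj0]; exact h1 j hj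
    · have hj0 : j ≠ ⟨0, hN⟩ := by
        intro e; rw [e] at hj
        have hj' : (0 : ℕ) ∈ JM1 := hj
        exact absurd hj' (by decide)
      show Function.update (fixJM x) ⟨0, hN⟩ (!fixJM x ⟨0, hN⟩) j = true
      rw [Function.update_of_ne hj0]; exact h2 j hj

/-- ResponseDialH helper `fixupM_agree` (decomp-qadv land package; see the module docstring). -/
theorem fixupM_agree (hN : 1 ≤ N) (x : Fin N → Bool) (j : Fin N) (hj : j.val ∉ JM) :
    fixupM hN x j = x j := by
  have hsub0 : ∀ v, v ∈ JM0 → v ∈ JM := by decide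
  have hsub1 : ∀ v, v ∈ JM1 → v ∈ JM := by decide
  have hJ : fixJM x j = x j := by
    unfold fixJM
    rw [if_neg (fun h => hj (hsub0 _ h)), if_neg (fun h => hj (hsub1 _ h))]
  have hj0 : j ≠ ⟨0, hN⟩ := by
    intro e; rw [e] at hj; exact hj (show (0 : ℕ) ∈ JM from by decide)
  unfold fixupM
  split_ifs
  · exact hJ
  · show Function.update (fixJM x) ⟨0, hN⟩ (!fixJM x ⟨0, hN⟩) j = x j
    rw [Function.update_of_ne hj0]; exact hJ

/-- the touched cells, as a subset of `Fin N` (at most 15 of them). -/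
def TM : Finset (Fin N) := univ.filter fun j => j.val ∈ JM

/-- ResponseDialH helper `TM_card_le` (decomp-qadv land package; see the module docstring). -/
theorem TM_card_le : (TM : Finset (Fin N)).card ≤ 15 := by
  have h := card_le_card_of_injOn (s := (TM : Finset (Fin N))) (t := JM) (fun j : Fin N => j.val)
    (fun j hj => by
      have hj' : j ∈ (TM : Finset (Fin N)) := hj
      unfold TM at hj'; exact (mem_filter.1 hj').2)
    (fun j₁ _ j₂ _ h => Fin.ext h)
  exact le_trans h (by decide)

/-- ResponseDialH helper `odd_le_fixM` (decomp-qadv land package; see the module docstring). -/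
theorem odd_le_fixM (hN : 40 ≤ N) :
    (univ.filter fun x : Fin N → Bool => OddZeros x).card ≤
      32768 * (univ.filter fun x : Fin N → Bool => OddZeros x ∧ FixM x).card := by
  refine card_le_mul_card_image_of_maps_to (f := fixupM (N := N) (by omega)) (fun x _ => ?_) 32768
    (fun y _ => ?_)
  · exact mem_filter.2 ⟨mem_univ _, fixupM_odd _ x, fixupM_fixM _ x⟩
  · refine le_trans (fibre_le_pow TM (fixupM (N := N) (by omega)) (fun x j hj => ?_) y _) ?_
    · refine fixupM_agree _ x j fun h => hj ?_
      unfold TM; exact mem_filter.2 ⟨mem_univ _, h⟩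
    · calc 2 ^ (TM : Finset (Fin N)).card ≤ 2 ^ 15 := Nat.pow_le_pow_right (by norm_num) TM_card_le
        _ = 32768 := by norm_num

/-- **multi-counter counting law**: `#odd ≤ 2²⁰ · #{odd losers}` for `n ≥ 40`. -/
theorem multiCounter_loss_count (n : ℕ) (hn : 40 ≤ n) :
    (univ.filter fun x : Fin n → Bool => OddZeros x).card ≤
      1048576 * (univ.filter fun x : Fin n → Bool =>
        OddZeros x ∧ ¬ Rel x (outB (fun i : Fin n => mcStrat i) x)).card :=
  calc (univ.filter fun x : Fin n → Bool => OddZeros x).card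
      ≤ 32768 * (univ.filter fun x : Fin n → Bool => OddZeros x ∧ FixM x).card := odd_le_fixM hn
    _ ≤ 32768 * (32 * (univ.filter fun x : Fin n → Bool =>
        OddZeros x ∧ ¬ Rel x (outB (fun i : Fin n => mcStrat i) x)).card) :=
        Nat.mul_le_mul_left _ (multi_loss_count hn)
    _ = _ := by ring

/-- **RUNG `MultiCounterLoss3` PROVED** (`C = 1`, `n₀ = 2²⁰`). -/
theorem multiCounterLoss3 : MultiCounterLoss3 :=
  ⟨1, 1048576, fun n hn => real_loss_of_frac (M := 1048576) (by norm_num) hn (by omega)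
    (fun i : Fin n => mcStrat i) (multiCounter_loss_count n (by omega))⟩

end MultiCounterLaw



end Summit.QuantumAdvantage.QuantumAdvantage.Theorems.ResponseDial
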